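import Mathlib
import HarnessLib
import Literature.MathematicalPhysics.KineticTheory.LangevinChainKernel
import Literature.MathematicalPhysics.KineticTheory.LangevinChainGibbs

/-!
# Sketch — first lemmas of the three crux ideas for `HonestZwanzig.OrthogonalOhm`
(crux item stmt-AtomisticToContinuum-12693; crux-ideate round 1, ideator 1).

Each `def … : Prop` is the FIRST CHECKABLE STATEMENT of one idea card, typed over existing
declarations (`pinnedChain`, `gibbsMeasure`, `transitionKernel`, `bondCurrent`, `generator`,
`partialQ`, `partialP`; the Liouvillian `L_H f = Σ_i (p_i ∂_{q_i} f − ∂_{q_i}H ∂_{p_i} f)` is inlined —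
it is literally `OscillatorChain.liouvillian` of `Literature/…/MomentumHermiteLadder.lean`, not imported
here only to keep this file independent of that module's build); nothing is proved here.
-/

namespace Summit.AtomisticToContinuum.FouriersLaw.Cruxes.OrthogonalOhm.IdeatorOne

open scoped BigOperators
open MeasureTheory Literature.MathematicalPhysics.KineticTheory.HeatConduction

/-- Card `nonlinear-zwanzig-gl-backflow`, first lemma **NoConditionalEuler**: under the Gibbs
measure the bond current is orthogonal to EVERY bounded measurable functional of the energy
profile `(e_0,…,e_{N-1})` (momentum parity), i.e. `E[j_b | e] = 0`: the nonlinear (conditional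
expectation) Zwanzig projection of the current sector vanishes, so the reduced profile dynamics
has no first-order (Euler) term at ANY polynomial order, and `j_b ∈ Ran Q_∞`. -/
def NoConditionalEuler : Prop :=
  ∀ ω₂ lam β γ : ℝ, 0 < ω₂ → 0 < lam → 0 < β → 0 < γ → ∀ T : ℝ, 0 < T → ∀ N : ℕ, 2 ≤ N →
    let P := pinnedChain ω₂ lam β γ
    let X := PhaseSpace N
    let μ : Measure X := P.gibbsMeasure N T
    let e : Fin N → X → ℝ := fun x z => z.2 x ^ 2 / 2 + P.U (z.1 x) +
      ∑ j : Fin N, ((if j.val = x.val + 1 then P.V (z.1 j - z.1 x) / 2 else 0) +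
        (if x.val = j.val + 1 then P.V (z.1 x - z.1 j) / 2 else 0))
    ∀ b : Fin N, ∀ Φ : (Fin N → ℝ) → ℝ, Measurable Φ → (∃ C : ℝ, ∀ v, |Φ v| ≤ C) →
      ∫ z, Φ (fun x => e x z) * P.bondCurrent N b z ∂μ = 0

/-- Card `nonlinear-zwanzig-gl-backflow`, second checkable statement **ReducedOnsagerSymmetry**
(finite `s`, fixed `N`): the Laplace-resolvent matrix elements of the TRUE dynamics between
functionals of the energy profile are symmetric,
`lap_s(Φ∘e, Ψ∘e) = lap_s(Ψ∘e, Φ∘e)` (time-reversal: profile functionals are even), which is the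
statement that the exactly reduced (non-Markovian) profile dynamics is REVERSIBLE with respect to
the push-forward of the Gibbs measure — the input that makes Ginzburg–Landau technology apply. -/
def ReducedOnsagerSymmetry : Prop :=
  ∀ ω₂ lam β γ : ℝ, 0 < ω₂ → 0 < lam → 0 < β → 0 < γ → ∀ T : ℝ, 0 < T → ∀ N : ℕ, 2 ≤ N →
    let P := pinnedChain ω₂ lam β γ
    let X := PhaseSpace N
    let μ : Measure X := P.gibbsMeasure N T
    let corr : (X → ℝ) → (X → ℝ) → ℝ → ℝ := fun f g t =>
      (∫ z, f z * (∫ y, g y ∂(P.transitionKernel N T T t.toNNReal z)) ∂μ) - (∫ z, f z ∂μ) * (∫ z, g z ∂μ)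
    let lap : ℝ → (X → ℝ) → (X → ℝ) → ℝ := fun s f g =>
      ∫ t in Set.Ioi (0 : ℝ), Real.exp (-(s * t)) * corr f g t
    let e : Fin N → X → ℝ := fun x z => z.2 x ^ 2 / 2 + P.U (z.1 x) +
      ∑ j : Fin N, ((if j.val = x.val + 1 then P.V (z.1 j - z.1 x) / 2 else 0) +
        (if x.val = j.val + 1 then P.V (z.1 x - z.1 j) / 2 else 0))
    ∀ Φ Ψ : (Fin N → ℝ) → ℝ, Measurable Φ → Measurable Ψ →
      (∃ C : ℝ, ∀ v, |Φ v| ≤ C ∧ |Ψ v| ≤ C) → ∀ s : ℝ, 0 < s →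
      lap s (fun z => Φ (fun x => e x z)) (fun z => Ψ (fun x => e x z)) =
        lap s (fun z => Ψ (fun x => e x z)) (fun z => Φ (fun x => e x z))

/-- Card `korn-bakry-emery-one-phonon-rigidity`, first lemma **OnePhononGap**: N-UNIFORM
mean-square frequency gap of the one-phonon (momentum-degree-one) sector of the isolated chain:
there is `c = c(ω₂, lam, β, T) > 0` such that for every `N` and every observable linear in the
momenta, `g = ∑_i p_i φ_i(q)` with `φ` smooth and compactly supported,
`c ∫ g² dμ ≤ ∫ (L_H g)² dμ` (`L_H` the Liouvillian, inlined; μ = Gibbs). Since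
`‖L_H g‖² = T²‖∇_ν^*φ‖² + 2T²‖Sym ∇φ‖²` (Gaussian momenta), this is a weighted Korn + Bakry–Émery
inequality for vector fields on `(ℝ^N, e^{-U_tot/T})`; it fails like `N⁻²` at `lam = β = 0`. -/
def OnePhononGap : Prop :=
  ∀ ω₂ lam β γ : ℝ, 0 < ω₂ → 0 < lam → 0 < β → 0 < γ → ∀ T : ℝ, 0 < T → ∃ c : ℝ, 0 < c ∧
    ∀ N : ℕ, 1 ≤ N →
    let P := pinnedChain ω₂ lam β γ
    let X := PhaseSpace N
    let μ : Measure X := P.gibbsMeasure N T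
    ∀ φ : Fin N → (Fin N → ℝ) → ℝ, (∀ i, ContDiff ℝ 2 (φ i)) → (∀ i, HasCompactSupport (φ i)) →
      let g : X → ℝ := fun z => ∑ i : Fin N, z.2 i * φ i z.1
      let LH : (X → ℝ) → X → ℝ := fun f z =>
        ∑ i : Fin N, (z.2 i * partialQ i f z - partialQ i (P.hamiltonian N) z * partialP i f z)
      c * ∫ z, g z ^ 2 ∂μ ≤ ∫ z, (LH g z) ^ 2 ∂μ

/-- Card `korn-bakry-emery-one-phonon-rigidity`, the exact identity behind it,
**OnePhononEnergyIdentity** (Gaussian integration by parts in the momenta; `ν` = position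
marginal): for `g = ∑_i p_i φ_i(q)`,
`∫ (L_H g)² dμ = T² ∫ (∑_i (∂_iφ_i − T⁻¹ ∂_iU_tot φ_i))² dμ + (T²/2) ∫ ∑_{i,j} (∂_iφ_j + ∂_jφ_i)² dμ`. -/
def OnePhononEnergyIdentity : Prop :=
  ∀ ω₂ lam β γ : ℝ, 0 < ω₂ → 0 < lam → 0 < β → 0 < γ → ∀ T : ℝ, 0 < T → ∀ N : ℕ, 1 ≤ N →
    let P := pinnedChain ω₂ lam β γ
    let X := PhaseSpace N
    let μ : Measure X := P.gibbsMeasure N T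
    ∀ φ : Fin N → (Fin N → ℝ) → ℝ, (∀ i, ContDiff ℝ 2 (φ i)) → (∀ i, HasCompactSupport (φ i)) →
      let g : X → ℝ := fun z => ∑ i : Fin N, z.2 i * φ i z.1
      let LH : (X → ℝ) → X → ℝ := fun f z =>
        ∑ i : Fin N, (z.2 i * partialQ i f z - partialQ i (P.hamiltonian N) z * partialP i f z)
      let dφ : Fin N → Fin N → (Fin N → ℝ) → ℝ := fun i j q =>
        deriv (fun s : ℝ => φ j (Function.update q i s)) (q i)
      ∫ z, (LH g z) ^ 2 ∂μ =
        T ^ 2 * ∫ z, (∑ i : Fin N, (dφ i i z.1 - T⁻¹ * partialQ i (P.hamiltonian N) z * φ i z.1)) ^ 2 ∂μ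
        + T ^ 2 / 2 * ∫ z, (∑ i : Fin N, ∑ j : Fin N, (dφ i j z.1 + dφ j i z.1) ^ 2) ∂μ

/-- Card `zero-frequency-ward-dictionary`, first lemma **SplittingIdentity** (exact, every
`s > 0`, fixed `N`): the current–energy Laplace block is a static covariance minus the heat
eventually dumped into the LEFT bath,
`lap_s(e_x, j_b) + γ·lap_s(e_x, p_0²) = Cov(e_x, E_{≤ b}) − s·lap_s(e_x, E_{≤ b})`,
`E_{≤ b} = ∑_{y ≤ b} e_y` (from `j_b = −L E_{≤b} + γ(T − p_0²)` and the Kolmogorov identity);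
at `s ↓ 0` the last term vanishes at fixed `N`, so the block `lap_0(e, j)` that enters
`schur_0 = lap_0 − lap_0(·,e)G(0)⁻¹lap_0(e,·)` is bounded by statics plus a splitting amplitude. -/
def SplittingIdentity : Prop :=
  ∀ ω₂ lam β γ : ℝ, 0 < ω₂ → 0 < lam → 0 < β → 0 < γ → ∀ T : ℝ, 0 < T → ∀ N : ℕ, 2 ≤ N →
    let P := pinnedChain ω₂ lam β γ
    let X := PhaseSpace N
    let μ : Measure X := P.gibbsMeasure N T
    let corr : (X → ℝ) → (X → ℝ) → ℝ → ℝ := fun f g t =>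
      (∫ z, f z * (∫ y, g y ∂(P.transitionKernel N T T t.toNNReal z)) ∂μ) - (∫ z, f z ∂μ) * (∫ z, g z ∂μ)
    let lap : ℝ → (X → ℝ) → (X → ℝ) → ℝ := fun s f g =>
      ∫ t in Set.Ioi (0 : ℝ), Real.exp (-(s * t)) * corr f g t
    let cov : (X → ℝ) → (X → ℝ) → ℝ := fun f g => (∫ z, f z * g z ∂μ) - (∫ z, f z ∂μ) * (∫ z, g z ∂μ)
    let e : Fin N → X → ℝ := fun x z => z.2 x ^ 2 / 2 + P.U (z.1 x) +
      ∑ j : Fin N, ((if j.val = x.val + 1 then P.V (z.1 j - z.1 x) / 2 else 0) +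
        (if x.val = j.val + 1 then P.V (z.1 x - z.1 j) / 2 else 0))
    ∀ x b : Fin N, b.val + 1 < N → ∀ s : ℝ, 0 < s →
      let Eleft : X → ℝ := fun z => ∑ y : Fin N, if y.val ≤ b.val then e y z else 0
      lap s (e x) (P.bondCurrent N b)
          + γ * lap s (e x) (fun z => ∑ i : Fin N, if i.val = 0 then z.2 i ^ 2 else 0) =
        cov (e x) Eleft - s * lap s (e x) Eleft

/-- Card `zero-frequency-ward-dictionary`, second identity **RowConstancy** (exact at every
`s > 0`): differences along a row of the bond–bond Laplace matrix are `O(s)` plus contact terms,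
`lap_s(j_b, j_{x−1}) − lap_s(j_b, j_x) = s·lap_s(j_b, e_x) + γ[x=0]·lap_s(j_b, p_0²) + γ[x=N−1]·lap_s(j_b, p_{N−1}²)`
(Kolmogorov identity `s·lap_s(j_b,e_x) − Cov(j_b,e_x) = lap_s(j_b, L e_x)`, parity
`Cov(j_b,e_x)=0`, and `L e_x = j_{x−1} − j_x + baths`); at `s = 0` the unprojected zero-frequency
bond–bond response is the CONSTANT matrix `c(N)·𝟙𝟙ᵀ` with `(N−1)c(N) = T²D_N`. -/
def RowConstancy : Prop :=
  ∀ ω₂ lam β γ : ℝ, 0 < ω₂ → 0 < lam → 0 < β → 0 < γ → ∀ T : ℝ, 0 < T → ∀ N : ℕ, 2 ≤ N →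
    let P := pinnedChain ω₂ lam β γ
    let X := PhaseSpace N
    let μ : Measure X := P.gibbsMeasure N T
    let corr : (X → ℝ) → (X → ℝ) → ℝ → ℝ := fun f g t =>
      (∫ z, f z * (∫ y, g y ∂(P.transitionKernel N T T t.toNNReal z)) ∂μ) - (∫ z, f z ∂μ) * (∫ z, g z ∂μ)
    let lap : ℝ → (X → ℝ) → (X → ℝ) → ℝ := fun s f g =>
      ∫ t in Set.Ioi (0 : ℝ), Real.exp (-(s * t)) * corr f g t
    let e : Fin N → X → ℝ := fun x z => z.2 x ^ 2 / 2 + P.U (z.1 x) +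
      ∑ j : Fin N, ((if j.val = x.val + 1 then P.V (z.1 j - z.1 x) / 2 else 0) +
        (if x.val = j.val + 1 then P.V (z.1 x - z.1 j) / 2 else 0))
    ∀ b x : Fin N, b.val + 1 < N → ∀ s : ℝ, 0 < s →
      (∑ y : Fin N, if y.val + 1 = x.val then lap s (P.bondCurrent N b) (P.bondCurrent N y) else 0)
        - lap s (P.bondCurrent N b) (P.bondCurrent N x) =
      s * lap s (P.bondCurrent N b) (e x)
        + (if x.val = 0 then γ * lap s (P.bondCurrent N b) (fun z => z.2 x ^ 2) else 0)
        + (if x.val = N - 1 then γ * lap s (P.bondCurrent N b) (fun z => z.2 x ^ 2) else 0)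

end Summit.AtomisticToContinuum.FouriersLaw.Cruxes.OrthogonalOhm.IdeatorOne
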